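import Mathlib.Analysis.SpecialFunctions.Complex.Arg
import Mathlib.Analysis.Calculus.Deriv.Basic
import Mathlib.Data.List.GetD
import Literature.Probability.RandomPlanarGeometry.FaceDGFF
import Literature.Probability.RandomPlanarGeometry.ConformalMap
import Literature.Probability.RandomPlanarGeometry.PlanarDomains
import HarnessLib

/-!
# The tilted level-line exploration of a face field on a discrete planar domain

Definition file (request `defn-TiltedLevelLineExploration` of route
`CriticalPhenomena/SAWScalingLimit/SAWDiscreteFlowLine`, card `discrete-imaginary-geometry-chi`;
consumers: the informal crux `DiscreteFlowLine` (stmt-CriticalPhenomena-8333) and the witness `F`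
of the crux `LatticeFlowLine` (stmt-CriticalPhenomena-8240), which asks for a map
`(faces → ℝ) → (ℕ → vertices)` whose values are frozen vertex sequences of walks of `Ω_δ`).

## The object

Schramm–Sheffield's **zero-height interface** of a discrete Gaussian free field with `∓λ` boundary
data (Acta Math. 202 (2009) = arXiv:math/0605337, §1.1 and §1.5, §2.2: on a TG-domain the hexagons
dual to the vertices are *positive* or *negative* according to the sign of the field, boundary
hexagons of the arc `∂₊` count as positive and of `∂₋` as negative, and the interface is the edge
path between the two clusters "oriented so that `D₊` is on its right" — "followed from bottom to
top, the interface `γ` turns right when it hits a negative hexagon, left when it hits a positive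
hexagon"; it runs from one endpoint of `∂₊` to the other) is here TRANSPLANTED TO THE FACES OF
`Ω_δ ⊆ δℤ²` (the field lives on the faces `faceDomain Ω δ` of `FaceDGFF.lean`, the interface runs
on PRIMAL edges of `Ω_δ = discreteDomainGraph Ω δ`, keeping `−` faces on its LEFT and `+` faces on
its RIGHT; the degree-4 vertices of `ℤ²` create SADDLES — ahead-left `+`, ahead-right `−` — which a
fixed turning rule resolves) and TILTED in the sense of Miller–Sheffield's imaginary geometry
(PTRF 164 (2016) = arXiv:1201.1496, §1.2 pp. 6–7: a flow line of `e^{ih/χ}` from `0` to `∞` in `ℍ`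
has boundary data `−λ` / `λ` on `ℝ₋` / `ℝ₊` and, along the path, "`−λ'` plus the winding on the
left and `λ'` plus the winding on the right … each time the path makes a quarter turn to the left,
heights go up by `πχ/2`"; so a point just right of the path sees `h > χ · (α − π/2)` and a point just
left sees `h < χ · (α − π/2)`, `α` the direction angle of the path, `= π/2` at the start; for `χ = 0`
this is the zero contour line, loc. cit. p. 7). The route's lattice reading (route file, crux
`DiscreteFlowLine`; "ℍ-bookkeeping", in which the branch of `arg (φ⁻¹)′` cancels between the
field's imaginary-geometry mean and the threshold): with `w = φ⁻¹ : D → ℍ` a chordal uniformizer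
(`a ↦ 0`, `b ↦ ∞`), `κ₀ = √(π/2)` the lattice-to-GFF normalisation of the face DGFF `h`, tilt `c`
and gap `λ`, an interior face `f` first examined at step `j` of the path is labelled

  `+  iff  κ₀ h(f) + λ − (2λ/π) arg w(centre f) > c · (α_ℍ(j) − π/2)`,

where `λ − (2λ/π) arg w` is the bounded harmonic function with boundary values `+λ` on `w⁻¹(ℝ₊)`
and `−λ` on `w⁻¹(ℝ₋)`, and `α_ℍ(j)` is the **chord-lifted ℍ-angle** of the path so far: with
`m = ⌈δ^{-1/2}⌉` and `p_i = w(δ · v(m i))` the `w`-images of every `m`-th vertex of the path frozen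
at its current tip `v(j)` (so the last chord ends at the tip), `α_ℍ(j) = π/2 + arg((p₁ − p₀)/i) +
∑_{i < ⌊j/m⌋} arg((p_{i+2} − p_{i+1})/(p_{i+1} − p_i))` — the unwrapped argument of the current
chord, anchored at `π/2` for a first chord leaving `0` vertically (this is verbatim the `ang` term of
the route file applied to the prefix-frozen path, hence adapted). For `c = 0` the labels do not
depend on the path and the exploration is the Schramm–Sheffield zero-height interface of
`κ₀ h + λ − (2λ/π) arg w` (`tiltedLabel_of_tilt_eq_zero`). At `κ = 8/3`: `λ = π √(3/8)`,
`λ' = π/√6`, `c = χ = 1/√6` (Miller–Sheffield 2016, Thm. 1.1; the tree's `igLambda`, `igChi`).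

## The definition

A deterministic function of the field, by iteration of a one-step map on states
`(tip, heading, path so far, face labels)` (`LevelLineState`):

* faces of `ℤ²` are indexed by their lower-left corner (`faceDomain`); the four faces at a vertex
  `v` are `quadFace v k`, `k : Fin 4` counterclockwise from NE; the four lattice directions are
  `latticeDir k` (E, N, W, S); the edge leaving `v` in direction `k` has `quadFace v k` on its left
  and `quadFace v (k+3)` on its right;
* one step (`levelLineStep`): if the tip is the target `b`, nothing happens (the sequence is frozen
  at `b`); otherwise every not-yet-labelled face among the four at the tip is labelled by the
  ORACLE (a function of the current state and the face — for the tilted exploration `tiltedLabel`: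
  the displayed test for faces of `faceDomain Ω δ`, and for the other ("boundary") faces the
  boundary side, `+` iff the face centre lies to the right of the imaginary axis of `ℍ` in the chart
  `w` linearised at the tip, `0 < Re (w(δ v) + w′(δ v) (centre f − δ v))` — the request's side rule
  "`arg w(centre f) < π/2`, or any equivalent side rule", read through the first-order Taylor
  expansion at the mesh point `δ v ∈ Ω` so that `w = φ⁻¹` is never evaluated outside the domain,
  where a `ConformalEquiv` carries junk values); labels are frozen at first examination
  (`levelLineStep_label_of_ne_none`); then the path moves along the first direction `d`, in the
  cyclic preference order fixed by the saddle rule (`SaddleRule.order`: right turn, straight, left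
  turn for `turnRight`; left, straight, right for `turnLeft`; reversal last), such that `v → v + e_d`
  is an edge of the graph and the face on its left is `−`, the face on its right `+`
  (`LevelLineState.Admissible`): ahead-left/ahead-right `= (−,+)` straight, `(+,+)` left, `(−,−)`
  right, `(+,−)` the saddle rule; if no direction is admissible the state is frozen ("stuck", junk);
* `levelLineExploration G oracle rule a b n` is the tip after `n` steps from the initial state
  (tip `a`, heading north — this only fixes the preference order among several admissible FIRST
  edges —, path `[a]`, no labels); consecutive values are equal or adjacent in `G`
  (`levelLineExploration_succ_eq_or_adj`), the value `b` is absorbing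
  (`levelLineExploration_eq_of_le`), the path either grows at every step or the state is frozen
  (`levelLineState_length_or_frozen`), and the recorded path read with default the tip is the
  prefix-frozen sequence `k ↦ η (min k n)` (`levelLineState_path_getD`);
* `tiltedLevelLineExploration Ω w δ a b c lam rule h := levelLineExploration (discreteDomainGraph Ω δ)
  (tiltedLabel Ω w δ c lam h) rule a b`, and for a Dobrushin domain with a uniformizer
  `φ : ℍ → D` the dot-notation `D.tiltedLevelLine φ δ a b c lam rule h` (with `w = φ.symm`).

Whether the path reaches `b` (it does when the boundary faces read `+` along the right arc and `−`
along the left arc with the switches exactly at `a`, `b`: Schramm–Sheffield's interface argument,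
§1.5; otherwise it freezes where stuck), edge-simplicity, and the domain Markov property of (path,
examined values) w.r.t. `faceDGFF` are the route's own items and are NOT asserted here (D-0026).

## References

* O. Schramm, S. Sheffield, *Contour lines of the two-dimensional discrete Gaussian free field*,
  Acta Math. 202 (2009) 21–137 = arXiv:math/0605337, §1.1 (dual picture, turning rule), §1.5 and
  §2.2 (interface oriented with `D₊` on its right, endpoints = endpoints of `∂₊`). [SchrammSheffield2009]
* J. Miller, S. Sheffield, *Imaginary geometry I: interacting SLEs*, PTRF 164 (2016) =
  arXiv:1201.1496, §1.2 pp. 6–7 (flow-line boundary data, quarter turns `± πχ/2`, `χ = 0` = zero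
  contour), Thm. 1.1 (constants). [MillerSheffield2016]
-/

noncomputable section

open scoped Classical
open Finset

namespace Literature.Probability.RandomPlanarGeometry

open Literature.Probability.LatticeModels

/-! ### Lattice directions and the four faces at a vertex -/

/-- The four lattice directions of `ℤ²` in counterclockwise order E, N, W, S as unit vectors:
`latticeDir 0 = (1,0)`, `latticeDir 1 = (0,1)`, `latticeDir 2 = (-1,0)`, `latticeDir 3 = (0,-1)`.
A left quarter turn is `k ↦ k + 1`, a right quarter turn `k ↦ k + 3`, the reversal `k ↦ k + 2`
(indices mod 4). [folklore] -/
def latticeDir : Fin 4 → Site 2 :=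
  ![![1, 0], ![0, 1], ![-1, 0], ![0, -1]]

/-- The four faces of `ℤ²` at the vertex `v` (a face = unit square indexed by its lower-left
corner, as in `faceDomain`), counterclockwise by quadrant: `quadFace v 0 = v` (NE),
`quadFace v 1 = v + (-1,0)` (NW), `quadFace v 2 = v + (-1,-1)` (SW), `quadFace v 3 = v + (0,-1)` (SE).
The edge leaving `v` in direction `latticeDir k` has `quadFace v k` on its LEFT and
`quadFace v (k + 3)` on its RIGHT; entering `v` with heading `d`, the faces ahead-left, behind-left,
behind-right, ahead-right are `quadFace v d, (d+1), (d+2), (d+3)`. [folklore] -/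
def quadFace (v : Site 2) (k : Fin 4) : Site 2 :=
  v + ![![0, 0], ![-1, 0], ![-1, -1], ![0, -1]] k

/-- `quadFace v 0 = v`: the NE face at `v` is the unit square with lower-left corner `v`. [folklore] -/
@[simp] theorem quadFace_zero (v : Site 2) : quadFace v 0 = v := by
  ext i; fin_cases i <;> simp [quadFace]

/-! ### The saddle rule and the state of the exploration -/

/-- The fixed turning rule at a **saddle** vertex of the square lattice (ahead-left face `+`,
ahead-right face `−`, where both quarter turns keep `−` on the left and `+` on the right): always
turn right, or always turn left. (On the hexagonal lattice of Schramm–Sheffield every vertex has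
degree `3` and no rule is needed.) [cite: SchrammSheffield2009, §1.1] -/
inductive SaddleRule
  /-- resolve saddles by turning right -/
  | turnRight
  /-- resolve saddles by turning left -/
  | turnLeft

/-- The cyclic **preference order** of exit directions at a vertex entered with heading `d`:
`[right turn d+3, straight d, left turn d+1, reversal d+2]` for `turnRight` and
`[left, straight, right, reversal]` for `turnLeft`. At a vertex entered consistently exactly one of
straight/left/right is label-consistent except at a saddle, where both turns are and the order
decides; the reversal is never consistent there and is listed for the first step only. [cite: SchrammSheffield2009, §1.1] -/
def SaddleRule.order : SaddleRule → Fin 4 → List (Fin 4)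
  | SaddleRule.turnRight, d => [d + 3, d, d + 1, d + 2]
  | SaddleRule.turnLeft, d => [d + 1, d, d + 3, d + 2]

/-- The state of a level-line exploration: the current tip, the heading (direction of the last
move; north initially), the vertices visited so far in order (first = start, last = tip), and the
face labels assigned so far (`none` = not yet examined, `some true` = `+` = to be kept on the RIGHT,
`some false` = `−` = kept on the LEFT). [cite: SchrammSheffield2009, §1.1] -/
@[ext] structure LevelLineState where
  /-- the current tip of the path -/
  tip : Site 2
  /-- the direction of the last move (`latticeDir heading`); `1` (north) before the first move -/
  heading : Fin 4
  /-- the vertices visited so far, in order -/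
  path : List (Site 2)
  /-- face labels: `none` unexamined, `some true` = `+` (right), `some false` = `−` (left) -/
  label : Site 2 → Option Bool

namespace LevelLineState

/-- **Examination**: every not-yet-labelled face among the four at the tip receives the label the
oracle assigns to it in the current state (all examined faces of one step see the same state);
labelled faces keep their label ("labels are frozen at first examination"). [cite: SchrammSheffield2009, §1.1] -/
def examine (oracle : LevelLineState → Site 2 → Bool) (s : LevelLineState) : LevelLineState where
  tip := s.tip
  heading := s.heading
  path := s.path
  label f := if s.label f = none ∧ ∃ k : Fin 4, quadFace s.tip k = f then some (oracle s f) else s.label f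

/-- The direction `d` is an **admissible exit** from the state `s` in the graph `G`: `tip → tip + e_d`
is an edge of `G`, the face on its left is labelled `−` and the face on its right `+` ("the walk
keeps `−` faces on its left and `+` faces on its right"; Schramm–Sheffield: the interface is
oriented so that the positive cluster is on its right). [cite: SchrammSheffield2009, §1.5] -/
def Admissible (G : SimpleGraph (Site 2)) (s : LevelLineState) (d : Fin 4) : Prop :=
  G.Adj s.tip (s.tip + latticeDir d) ∧ s.label (quadFace s.tip d) = some false ∧
    s.label (quadFace s.tip (d + 3)) = some true

/-- Moving the tip one lattice step in direction `d` (appending the new tip to the path). [folklore] -/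
def move (s : LevelLineState) (d : Fin 4) : LevelLineState where
  tip := s.tip + latticeDir d
  heading := d
  path := s.path ++ [s.tip + latticeDir d]
  label := s.label

/-- The first admissible exit in the preference order of the saddle rule, if any. [cite: SchrammSheffield2009, §1.1] -/
def exit? (G : SimpleGraph (Site 2)) (rule : SaddleRule) (s : LevelLineState) : Option (Fin 4) :=
  (rule.order s.heading).find? fun d => decide (s.Admissible G d)

/-- A returned exit is admissible. [folklore] -/
theorem admissible_of_exit?_eq_some {G : SimpleGraph (Site 2)} {rule : SaddleRule}
    {s : LevelLineState} {d : Fin 4} (h : s.exit? G rule = some d) : s.Admissible G d := by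
  have := List.find?_some h
  simpa using this

end LevelLineState

/-! ### The exploration machine -/

/-- **One step of the level-line exploration** in the graph `G` with labelling `oracle`, saddle
rule `rule` and target `b`: a state whose tip is `b` is left unchanged (the path is frozen once it
reaches `b`); otherwise the faces at the tip are examined and the path moves along the first
admissible exit in the preference order — ahead-left/ahead-right `(−,+)`: straight, `(+,+)`: left
turn, `(−,−)`: right turn ("turns right when it hits a negative hexagon, left when it hits a
positive hexagon"), `(+,−)`: saddle, resolved by `rule` —; with no admissible exit the examined
state is returned unchanged ("stuck": the sequence freezes there; junk). [cite: SchrammSheffield2009, §1.1] -/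
def levelLineStep (G : SimpleGraph (Site 2)) (oracle : LevelLineState → Site 2 → Bool)
    (rule : SaddleRule) (b : Site 2) (s : LevelLineState) : LevelLineState :=
  if s.tip = b then s
  else ((s.examine oracle).exit? G rule).elim (s.examine oracle) (s.examine oracle).move

/-- The initial state at the start vertex `a`: tip `a`, heading north (this only fixes the cyclic
preference order among several admissible first edges), path `[a]`, no face examined. [cite: SchrammSheffield2009, §1.5] -/
def levelLineInit (a : Site 2) : LevelLineState where
  tip := a
  heading := 1
  path := [a]
  label _ := none

/-- The state of the exploration from `a` towards `b` after `n` steps. [cite: SchrammSheffield2009, §1.1] -/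
def levelLineState (G : SimpleGraph (Site 2)) (oracle : LevelLineState → Site 2 → Bool)
    (rule : SaddleRule) (a b : Site 2) (n : ℕ) : LevelLineState :=
  (levelLineStep G oracle rule b)^[n] (levelLineInit a)

/-- **The level-line exploration** from `a` towards `b` in `G` driven by `oracle`, as a vertex
sequence `ℕ → ℤ²`: the tip after `n` steps. It starts at `a` (`levelLineExploration_zero`),
consecutive values are equal or `G`-adjacent (`levelLineExploration_succ_eq_or_adj`), and it is
constant from the first visit to `b` on (`levelLineExploration_eq_of_le`) — the format
`i ↦ ω.getVert i` of a walk `ω` frozen at its endpoint used by the route's cruxes. [cite: SchrammSheffield2009, §1.5] -/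
def levelLineExploration (G : SimpleGraph (Site 2)) (oracle : LevelLineState → Site 2 → Bool)
    (rule : SaddleRule) (a b : Site 2) : ℕ → Site 2 :=
  fun n => (levelLineState G oracle rule a b n).tip

/-! ### The tilted labelling oracle -/

/-- The block length `m = ⌈δ^{-1/2}⌉` of the `√δ`-chords (the `bl` term of the route file; `0` for
`δ ≤ 0`, junk). [cite: MillerSheffield2016, §1.2] -/
def blockLength (δ : ℝ) : ℕ :=
  ⌈(Real.sqrt δ)⁻¹⌉₊

/-- **The chord-lifted ℍ-angle** of a vertex sequence `v` after `B` blocks, read in the chart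
`w : D → ℍ`: with `p_i = w (δ · v (m i))`, `m = blockLength δ`,
`chordAngle w δ v B = π/2 + arg((p₁ − p₀)/i) + ∑_{i < B} arg((p_{i+2} − p_{i+1})/(p_{i+1} − p_i))` —
the argument of the `B`-th chord unwrapped along the chord sequence (each turning angle read in
`(−π, π]`) and anchored so that a first chord pointing vertically up has angle `π/2` ("we may assume
that `η` starts out in the vertical direction, so that the winding number is approximately `π/2`").
This is verbatim the `ang` term of the cruxes of route `SAWDiscreteFlowLine`. Degenerate chords
contribute `arg 0 = 0`. [cite: MillerSheffield2016, §1.2] -/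
def chordAngle (w : ℂ → ℂ) (δ : ℝ) (v : ℕ → Site 2) (B : ℕ) : ℝ :=
  let p : ℕ → ℂ := fun i => w (meshPoint δ (v (blockLength δ * i)))
  Real.pi / 2 + Complex.arg ((p 1 - p 0) / Complex.I) +
    ∑ i ∈ range B, Complex.arg ((p (i + 2) - p (i + 1)) / (p (i + 1) - p i))

/-- **The tilted labelling oracle** of the field `h` on the faces of `Ω_δ`, in the chart `w : Ω → ℍ`
(`w = φ⁻¹` for a chordal uniformizer `φ`), with tilt `c` and gap `lam = λ`. A face `f ∈ faceDomain Ω δ`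
examined in state `s` (step `j = |path| − 1`) is labelled `+` iff
`√(π/2) · h f + λ − (2λ/π) · arg (w (faceCentre δ f)) > c · (α_ℍ(j) − π/2)` with
`α_ℍ(j) = chordAngle w δ (path frozen at its tip) ⌊j/m⌋` (Miller–Sheffield: right of a flow line
the field exceeds `χ ·` winding, "each quarter turn to the left raises heights by `πχ/2`"; `λ −
(2λ/π) arg w` = harmonic extension of the boundary data `±λ`). Any other face (a boundary face of
`Ω_δ`) is labelled by its boundary side: `+` iff `0 < Re (w(δ v) + w′(δ v) · (faceCentre δ f − δ v))`,
`v` the tip from which it is examined — the side of the imaginary axis (the geodesic from `0 = w(a)`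
to `∞ = w(b)`) on which the face centre lies in the chart linearised at the mesh point `δ v ∈ Ω`,
so that `w` and `w′ = deriv w` are only read inside `Ω` (Schramm–Sheffield: hexagons of `∂₊`, the
arc mapped to `(0, ∞)`, are positive). [cite: MillerSheffield2016, §1.2] -/
def tiltedLabel (Ω : Set ℂ) (w : ℂ → ℂ) (δ c lam : ℝ) (h : Site 2 → ℝ) (s : LevelLineState)
    (f : Site 2) : Bool :=
  if f ∈ faceDomain Ω δ then
    decide (c * (chordAngle w δ (fun k => s.path.getD k s.tip) ((s.path.length - 1) / blockLength δ)
        - Real.pi / 2) <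
      Real.sqrt (Real.pi / 2) * h f + lam - 2 * lam / Real.pi * Complex.arg (w (faceCentre δ f)))
  else
    decide (0 < (w (meshPoint δ s.tip) +
      deriv w (meshPoint δ s.tip) * (faceCentre δ f - meshPoint δ s.tip)).re)

/-- **The tilted level-line exploration** `η_δ` of the face field `h` on `Ω_δ` from `a` towards `b`,
in the chart `w : Ω → ℍ`, with tilt `c`, gap `lam` and saddle rule `rule`: the level-line
exploration in `discreteDomainGraph Ω δ` driven by `tiltedLabel Ω w δ c lam h`, as a vertex sequence
`ℕ → ℤ²` frozen at `b`. For `c = 0` it is the Schramm–Sheffield zero-height interface of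
`√(π/2) h + λ − (2λ/π) arg w` transplanted to the faces of `δℤ²`; the route `SAWDiscreteFlowLine`
uses `c = χ = 1/√6`, `lam = λ = π √(3/8)` (`κ = 8/3`) and `h` a sample of `faceDGFF Ω δ`.
[cite: SchrammSheffield2009, §1.5] -/
def tiltedLevelLineExploration (Ω : Set ℂ) (w : ℂ → ℂ) (δ : ℝ) (a b : Site 2) (c lam : ℝ)
    (rule : SaddleRule) (h : Site 2 → ℝ) : ℕ → Site 2 :=
  levelLineExploration (discreteDomainGraph Ω δ) (tiltedLabel Ω w δ c lam h) rule a b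

open UpperHalfPlane (upperHalfPlaneSet) in
/-- The tilted level-line exploration of a Dobrushin domain `(D; a, b)` read through a conformal
equivalence `φ : ℍ → D` (intended: a chordal uniformizer, `φ(0) = a`, `φ(∞) = b`): the chart is
`w = φ.symm`. Dot notation: `D.tiltedLevelLine φ δ a_δ b_δ c lam rule h`. [cite: MillerSheffield2016, §1.2] -/
abbrev MarkedDomain.tiltedLevelLine (D : DobrushinDomain)
    (φ : ConformalEquiv upperHalfPlaneSet D.carrier) (δ : ℝ) (a b : Site 2) (c lam : ℝ)
    (rule : SaddleRule) (h : Site 2 → ℝ) : ℕ → Site 2 :=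
  tiltedLevelLineExploration D.carrier φ.symm δ a b c lam rule h

/-! ### API -/

section API

variable {G : SimpleGraph (Site 2)} {oracle : LevelLineState → Site 2 → Bool} {rule : SaddleRule}
  {a b : Site 2}

/-- A state at the target is frozen. [cite: SchrammSheffield2009, §1.5] -/
theorem levelLineStep_of_tip_eq {s : LevelLineState} (h : s.tip = b) :
    levelLineStep G oracle rule b s = s := by
  simp [levelLineStep, h]

/-- The state recursion. [folklore] -/
theorem levelLineState_succ (n : ℕ) :
    levelLineState G oracle rule a b (n + 1) =
      levelLineStep G oracle rule b (levelLineState G oracle rule a b n) := by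
  simp [levelLineState, Function.iterate_succ_apply']

/-- The exploration starts at `a`. [cite: SchrammSheffield2009, §1.5] -/
@[simp] theorem levelLineExploration_zero : levelLineExploration G oracle rule a b 0 = a := rfl

/-- **Labels are frozen at first examination**: one step never changes an assigned label. [cite: SchrammSheffield2009, §1.1] -/
theorem levelLineStep_label_of_ne_none {s : LevelLineState} {f : Site 2} (h : s.label f ≠ none) :
    (levelLineStep G oracle rule b s).label f = s.label f := by
  have hex : (s.examine oracle).label f = s.label f := by
    simp [LevelLineState.examine, h]
  unfold levelLineStep
  split_ifs with hb
  · rfl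
  · cases hq : (s.examine oracle).exit? G rule with
    | none => simpa using hex
    | some d => simpa [LevelLineState.move] using hex

/-- One step either leaves the tip in place or moves it to a `G`-neighbour. [cite: SchrammSheffield2009, §1.1] -/
theorem levelLineStep_tip_eq_or_adj (s : LevelLineState) :
    (levelLineStep G oracle rule b s).tip = s.tip ∨ G.Adj s.tip (levelLineStep G oracle rule b s).tip := by
  unfold levelLineStep
  split_ifs with hb
  · exact Or.inl rfl
  · cases hq : (s.examine oracle).exit? G rule with
    | none => exact Or.inl (by simp [LevelLineState.examine])
    | some d =>
      right
      have had := LevelLineState.admissible_of_exit?_eq_some hq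
      simpa [LevelLineState.move, LevelLineState.examine, LevelLineState.Admissible] using had.1

/-- **The exploration is a lazy walk of `G`**: consecutive values coincide or are adjacent. [cite: SchrammSheffield2009, §1.1] -/
theorem levelLineExploration_succ_eq_or_adj (n : ℕ) :
    levelLineExploration G oracle rule a b (n + 1) = levelLineExploration G oracle rule a b n ∨
      G.Adj (levelLineExploration G oracle rule a b n) (levelLineExploration G oracle rule a b (n + 1)) := by
  simp only [levelLineExploration, levelLineState_succ]
  exact levelLineStep_tip_eq_or_adj _

/-- **The target is absorbing**: once the exploration is at `b` it stays there. [cite: SchrammSheffield2009, §1.5] -/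
theorem levelLineExploration_eq_of_le {n k : ℕ} (h : levelLineExploration G oracle rule a b n = b)
    (hk : n ≤ k) : levelLineExploration G oracle rule a b k = b := by
  induction hk with
  | refl => exact h
  | step _ ih =>
    simp only [levelLineExploration, levelLineState_succ] at ih ⊢
    rw [levelLineStep_of_tip_eq ih, ih]

/-- A constant (not yet started) path has chord-lifted angle `π/2`: the anchoring convention. [cite: MillerSheffield2016, §1.2] -/
@[simp] theorem chordAngle_const (w : ℂ → ℂ) (δ : ℝ) (x : Site 2) (B : ℕ) :
    chordAngle w δ (fun _ => x) B = Real.pi / 2 := by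
  simp [chordAngle]

/-- **At zero tilt the labels do not depend on the path**: a face of the face-domain is `+` iff
`√(π/2) h f + λ − (2λ/π) arg w(centre f) > 0` — the Schramm–Sheffield zero-height interface of the
field plus the harmonic extension of the `±λ` boundary data ("if `χ = 0` … `η` is a zero-height
contour line of `h`"). [cite: MillerSheffield2016, §1.2] -/
theorem tiltedLabel_of_tilt_eq_zero {Ω : Set ℂ} {w : ℂ → ℂ} {δ lam : ℝ} {h : Site 2 → ℝ}
    (s : LevelLineState) {f : Site 2} (hf : f ∈ faceDomain Ω δ) :
    tiltedLabel Ω w δ 0 lam h s f =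
      decide (0 < Real.sqrt (Real.pi / 2) * h f + lam - 2 * lam / Real.pi * Complex.arg (w (faceCentre δ f))) := by
  simp [tiltedLabel, hf]

/-- The tilted exploration starts at `a`. [cite: SchrammSheffield2009, §1.5] -/
@[simp] theorem tiltedLevelLineExploration_zero (Ω : Set ℂ) (w : ℂ → ℂ) (δ : ℝ) (a b : Site 2)
    (c lam : ℝ) (rule : SaddleRule) (h : Site 2 → ℝ) :
    tiltedLevelLineExploration Ω w δ a b c lam rule h 0 = a := rfl

/-- The tilted exploration is a lazy walk of `Ω_δ`. [cite: SchrammSheffield2009, §1.1] -/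
theorem tiltedLevelLineExploration_succ_eq_or_adj (Ω : Set ℂ) (w : ℂ → ℂ) (δ : ℝ) (a b : Site 2)
    (c lam : ℝ) (rule : SaddleRule) (h : Site 2 → ℝ) (n : ℕ) :
    tiltedLevelLineExploration Ω w δ a b c lam rule h (n + 1) =
        tiltedLevelLineExploration Ω w δ a b c lam rule h n ∨
      (discreteDomainGraph Ω δ).Adj (tiltedLevelLineExploration Ω w δ a b c lam rule h n)
        (tiltedLevelLineExploration Ω w δ a b c lam rule h (n + 1)) :=
  levelLineExploration_succ_eq_or_adj n

/-- Examination is idempotent: the faces at the tip are labelled once. [cite: SchrammSheffield2009, §1.1] -/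
theorem LevelLineState.examine_examine (oracle : LevelLineState → Site 2 → Bool) (s : LevelLineState) :
    (s.examine oracle).examine oracle = s.examine oracle := by
  refine LevelLineState.ext rfl rfl rfl (funext fun f => ?_)
  show (if _ then _ else _) = _
  rw [if_neg]
  rintro ⟨h1, h2⟩
  have h2' : ∃ k : Fin 4, quadFace s.tip k = f := h2
  simp only [LevelLineState.examine] at h1
  split_ifs at h1 with h3
  exact h3 ⟨h1, h2'⟩

/-- A stuck state (no admissible exit after examination, tip not at the target) is a fixed point
from the next step on. [cite: SchrammSheffield2009, §1.1] -/
theorem levelLineStep_levelLineStep_of_exit?_eq_none {s : LevelLineState} (hb : s.tip ≠ b)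
    (hq : (s.examine oracle).exit? G rule = none) :
    levelLineStep G oracle rule b (levelLineStep G oracle rule b s) = levelLineStep G oracle rule b s := by
  have h1 : levelLineStep G oracle rule b s = s.examine oracle := by
    simp [levelLineStep, hb, hq]
  rw [h1, levelLineStep, if_neg (show (s.examine oracle).tip ≠ b from hb),
    LevelLineState.examine_examine, hq]
  rfl

/-- One step either keeps tip and path, or appends the new tip to the path. [folklore] -/
theorem levelLineStep_path (s : LevelLineState) :
    ((levelLineStep G oracle rule b s).path = s.path ∧ (levelLineStep G oracle rule b s).tip = s.tip) ∨
      (levelLineStep G oracle rule b s).path = s.path ++ [(levelLineStep G oracle rule b s).tip] := by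
  unfold levelLineStep
  split_ifs with hb
  · exact Or.inl ⟨rfl, rfl⟩
  · cases hq : (s.examine oracle).exit? G rule with
    | none => exact Or.inl ⟨rfl, rfl⟩
    | some d => exact Or.inr rfl

/-- **Growth dichotomy**: after `n` steps either the path has `n + 1` vertices (it moved at every
step) or the exploration is frozen (at the target, or stuck). [cite: SchrammSheffield2009, §1.5] -/
theorem levelLineState_length_or_frozen (n : ℕ) :
    (levelLineState G oracle rule a b n).path.length = n + 1 ∨
      levelLineStep G oracle rule b (levelLineState G oracle rule a b n) =
        levelLineState G oracle rule a b n := by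
  induction n with
  | zero => exact Or.inl rfl
  | succ n ih =>
    rw [levelLineState_succ]
    rcases ih with hlen | hfix
    · set s := levelLineState G oracle rule a b n with hs
      by_cases hb : s.tip = b
      · right; rw [levelLineStep_of_tip_eq hb, levelLineStep_of_tip_eq hb]
      · cases hq : (s.examine oracle).exit? G rule with
        | none => exact Or.inr (levelLineStep_levelLineStep_of_exit?_eq_none hb hq)
        | some d =>
          left
          have : levelLineStep G oracle rule b s = (s.examine oracle).move d := by
            simp [levelLineStep, hb, hq]
          rw [this]
          simp [LevelLineState.move, LevelLineState.examine, hlen]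
    · right; rw [hfix, hfix]

/-- **The path component is the prefix-frozen exploration**: after `n` steps, reading the recorded
path with default the tip gives `k ↦ η (min k n)` — the form in which the route's cruxes feed path
prefixes (`fun i => v (min i k)`) into `chordAngle`. [cite: SchrammSheffield2009, §1.5] -/
theorem levelLineState_path_getD (n k : ℕ) :
    (levelLineState G oracle rule a b n).path.getD k (levelLineState G oracle rule a b n).tip =
      levelLineExploration G oracle rule a b (min k n) := by
  induction n generalizing k with
  | zero => cases k <;> simp [levelLineState, levelLineInit, levelLineExploration]
  | succ n ih =>
    have hF : ∀ m, levelLineExploration G oracle rule a b m = (levelLineState G oracle rule a b m).tip :=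
      fun m => rfl
    -- case (a): tip and path unchanged
    have caseA : (levelLineState G oracle rule a b (n + 1)).path = (levelLineState G oracle rule a b n).path →
        (levelLineState G oracle rule a b (n + 1)).tip = (levelLineState G oracle rule a b n).tip →
        (levelLineState G oracle rule a b (n + 1)).path.getD k (levelLineState G oracle rule a b (n + 1)).tip =
          levelLineExploration G oracle rule a b (min k (n + 1)) := by
      intro hp ht
      rw [hp, ht, ih k]
      rcases le_or_gt k n with hk | hk
      · rw [min_eq_left hk, min_eq_left (hk.trans n.le_succ)]
      · rw [min_eq_right hk.le, min_eq_right (Nat.succ_le_of_lt hk), hF, hF, ht]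
    rcases levelLineState_length_or_frozen (G := G) (oracle := oracle) (rule := rule) (a := a) (b := b) n
      with hlen | hfix
    · rcases levelLineStep_path (G := G) (oracle := oracle) (rule := rule) (b := b)
        (levelLineState G oracle rule a b n) with ⟨hp, ht⟩ | happ
      · rw [← levelLineState_succ] at hp ht
        exact caseA hp ht
      · rw [← levelLineState_succ] at happ
        rw [happ]
        rcases Nat.lt_or_ge k (n + 1) with hk | hk
        · have hkl : k < (levelLineState G oracle rule a b n).path.length := by omega
          rw [List.getD_append _ _ _ _ hkl, List.getD_eq_getElem _ _ hkl, min_eq_left (by omega : k ≤ n + 1)]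
          have := ih k
          rw [List.getD_eq_getElem _ _ hkl, min_eq_left (by omega : k ≤ n)] at this
          exact this
        · have hkl : (levelLineState G oracle rule a b n).path.length ≤ k := by omega
          rw [List.getD_append_right _ _ _ _ hkl, min_eq_right hk, hF]
          rcases Nat.lt_or_ge (k - (levelLineState G oracle rule a b n).path.length) 1 with h1 | h1
          · have h0 : k - (levelLineState G oracle rule a b n).path.length = 0 := by omega
            rw [h0]
            simp
          · exact List.getD_eq_default _ _ (by simpa using h1)
    · have h' : levelLineState G oracle rule a b (n + 1) = levelLineState G oracle rule a b n := by
        rw [levelLineState_succ, hfix]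
      exact caseA (by rw [h']) (by rw [h'])

end API

end Literature.Probability.RandomPlanarGeometry
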